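import Literature.Geometry.Riemannian.PinchingEstimatesSingularMax
import HarnessLib

/-!
# Maximising pairs of 2-frames for `b₂ + b₃ = max (u₁ᵀBv₁ + u₂ᵀBv₂)`: first-order structure
(topic `Geometry/Riemannian`)

Part of the decomposition of `Literature.Geometry.Riemannian.hamilton_chenZhu_pinching`
(`PinchingEstimates.lean`), towards the ODE part of Hamilton 1997, Thm. 1.3
(`(b₂ + b₃)² ≤ Λ(a₁ + a₂)(c₁ + c₂)` is preserved; proof p. 8: `d/dt ln(b₂ + b₃) ≤ a₃ + c₃ + 2b₁`).
In the tree's variational language `b₂ + b₃` is the maximum of the Ky Fan bilinear sum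
`u₁ᵀBv₁ + u₂ᵀBv₂` over pairs of orthonormal 2-frames (`HamiltonODE.SingularValuesSumSqLE`).
PROVED here, for any `B` and a maximising configuration `(u₁, u₂; v₁, v₂)` with normals
`u₀ = u₁ × u₂`, `v₀ = v₁ × v₂` and block `Mᵢⱼ = uᵢᵀBvⱼ`:

* `kyFanMax_normal` — `u₀ᵀBvⱼ = 0 = uᵢᵀBv₀` (variations towards the normals), hence
  `Bv₀ = κu₀`, `ᵗBu₀ = κv₀` with `κ = u₀ᵀBv₀`, and `Bvⱼ`, `ᵗBuᵢ` lie in the frames' planes;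
* `kyFanMax_symm`, `kyFanMax_diag_nonneg`, `kyFanMax_kappa_le` — `M` is symmetric with
  `Mᵢᵢ ≥ |κ|` (in-plane rotations, sign flips, and the competitors `(u₀, u₂; v₀, v₂)`);
* `sharp_mulVec_cross` — the cofactor identity `B^#(x × y) = Bx × By`, whence Hamilton's
  `B^#`-terms `u₁ᵀB^#v₁ = κM₂₂`, `u₂ᵀB^#v₂ = κM₁₁` at a maximiser (`kyFanMax_sharp_sum`);
* `kyFan_rotate`, `exists_halfAngle` — simultaneous in-plane rotation of both frames preserves
  the Ky Fan sum of every matrix, and a rotation annihilating `M₁₂` exists.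

## References

* R. S. Hamilton, Comm. Anal. Geom. 5 (1997), §2.1, Thm. 1.3 (proof, p. 8). [Hamilton1997]
* R. S. Hamilton, J. Differential Geom. 24 (1986), §6, Lemma 6.1 (p. 167). [Hamilton1986]
-/

noncomputable section

open Set Real
open scoped Matrix BigOperators

namespace Literature.Geometry.Riemannian

namespace HamiltonODE

variable {B : Matrix (Fin 3) (Fin 3) ℝ}

/-! ### Tools -/

/-- Expansion of a vector in an orthonormal basis of `ℝ³`. [folklore] -/
theorem expand_orthonormal {e₁ e₂ e₃ : Fin 3 → ℝ} (h₁ : e₁ ⬝ᵥ e₁ = 1) (h₂ : e₂ ⬝ᵥ e₂ = 1)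
    (h₃ : e₃ ⬝ᵥ e₃ = 1) (h₁₂ : e₁ ⬝ᵥ e₂ = 0) (h₁₃ : e₁ ⬝ᵥ e₃ = 0) (h₂₃ : e₂ ⬝ᵥ e₃ = 0)
    (x : Fin 3 → ℝ) : x = (e₁ ⬝ᵥ x) • e₁ + (e₂ ⬝ᵥ x) • e₂ + (e₃ ⬝ᵥ x) • e₃ := by
  set R : Matrix (Fin 3) (Fin 3) ℝ := Matrix.of ![e₁, e₂, e₃] with hR
  have hRRt : R * Rᵀ = 1 := frame3_mul_transpose h₁ h₂ h₃ h₁₂ h₁₃ h₂₃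
  have hRtR : Rᵀ * R = 1 := mul_eq_one_comm.1 hRRt
  have key : Rᵀ *ᵥ (R *ᵥ x) = x := by rw [Matrix.mulVec_mulVec, hRtR, Matrix.one_mulVec]
  have e : Rᵀ *ᵥ (R *ᵥ x) = (e₁ ⬝ᵥ x) • e₁ + (e₂ ⬝ᵥ x) • e₂ + (e₃ ⬝ᵥ x) • e₃ := by
    ext i
    simp [R, Matrix.mulVec, dotProduct, Fin.sum_univ_three, Matrix.transpose_apply]
    ring
  rw [← e, key]

/-- **First-order optimality for a linear functional on the sphere**: if
`(α + tβ)/√(1 + t²) ≤ α` for all real `t` then `β = 0`. [folklore] -/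
theorem eq_zero_of_linear_variation {α β : ℝ} (h : ∀ t : ℝ, (1 + t ^ 2)⁻¹.sqrt * (α + t * β) ≤ α) :
    β = 0 := by
  by_contra hβ
  have hb2 : 0 < β ^ 2 := by positivity
  -- use `t = β/(|α| + 1)`; then `α + tβ > 0` and squaring gives a contradiction
  set t := β / (|α| + 1) with ht
  have hpos : 0 < |α| + 1 := by positivity
  have htβ : t * β = β ^ 2 / (|α| + 1) := by rw [ht]; field_simp
  have h1 := h t
  have hc : 0 < (1 + t ^ 2)⁻¹.sqrt := Real.sqrt_pos.2 (by positivity)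
  have hc2 : (1 + t ^ 2)⁻¹.sqrt ^ 2 = (1 + t ^ 2)⁻¹ := Real.sq_sqrt (by positivity)
  -- `α + tβ ≤ α √(1+t²)`-type manipulation: from `c (α + tβ) ≤ α` and `c > 0`
  have h2 : α + t * β ≤ α / (1 + t ^ 2)⁻¹.sqrt := by rwa [le_div_iff₀' hc]
  have ht2 : t ^ 2 = β ^ 2 / (|α| + 1) ^ 2 := by rw [ht, div_pow]
  rcases le_or_gt α 0 with hα | hα
  · -- `α ≤ 0`: then `c(α + tβ) ≤ α ≤ cα` forces `tβ ≤ 0`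
    have : (1 + t ^ 2)⁻¹.sqrt * (α + t * β) ≤ (1 + t ^ 2)⁻¹.sqrt * α := by
      refine h1.trans ?_
      have hc1 : (1 + t ^ 2)⁻¹.sqrt ≤ 1 := by
        rw [Real.sqrt_le_one, inv_le_one_iff₀]; right; nlinarith
      nlinarith
    have h3 : t * β ≤ 0 := by nlinarith
    rw [htβ] at h3
    have := div_pos hb2 hpos
    linarith
  · -- `α > 0`: square `α + tβ ≤ α/c`, i.e. `(α + tβ)² c² ≤ α²`
    have h4 : 0 < α + t * β := by rw [htβ]; positivity
    have h5 : (α + t * β) * (1 + t ^ 2)⁻¹.sqrt ≤ α := by nlinarith [h1]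
    have h6 : ((α + t * β) * (1 + t ^ 2)⁻¹.sqrt) ^ 2 ≤ α ^ 2 := by
      exact pow_le_pow_left₀ (by positivity) h5 2
    rw [mul_pow, hc2] at h6
    have h7 : (α + t * β) ^ 2 ≤ α ^ 2 * (1 + t ^ 2) := by
      have hi : 0 < (1 + t ^ 2) := by positivity
      rw [← div_eq_mul_inv, div_le_iff₀ hi] at h6
      linarith
    -- expand: `2αtβ + t²β² ≤ α² t²`, with `tβ = β²/(|α|+1)`, `t² = β²/(|α|+1)²`, `|α| = α`
    rw [abs_of_pos hα] at htβ ht2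
    rw [ht2] at h7
    have e1 : (α + t * β) ^ 2 = α ^ 2 + 2 * α * (β ^ 2 / (α + 1)) + (β ^ 2 / (α + 1)) ^ 2 := by
      rw [← htβ]; ring
    rw [e1] at h7
    have hq : 0 < β ^ 2 / (α + 1) := div_pos hb2 (by linarith)
    have e2 : α ^ 2 * (1 + β ^ 2 / (α + 1) ^ 2) = α ^ 2 + α ^ 2 / (α + 1) * (β ^ 2 / (α + 1)) := by
      field_simp
    rw [e2] at h7
    -- `2α q + q² ≤ (α²/(α+1)) q` with `q > 0`, but `α²/(α+1) < α < 2α`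
    have h8 : α ^ 2 / (α + 1) < 2 * α := by
      rw [div_lt_iff₀ (by linarith)]; nlinarith
    nlinarith [mul_lt_mul_of_pos_right h8 hq]

/-- **The cofactor identity** `B^#(x × y) = Bx × By` (`B^# = ᵗadj B` is the cofactor matrix).
[folklore] -/
theorem sharp_mulVec_cross (B : Matrix (Fin 3) (Fin 3) ℝ) (x y : Fin 3 → ℝ) :
    B.sharp *ᵥ (x ⨯₃ y) = (B *ᵥ x) ⨯₃ (B *ᵥ y) := by
  ext i
  simp only [Matrix.sharp, Matrix.mulVec, dotProduct, Matrix.transpose_apply,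
    Matrix.adjugate_fin_three, cross_apply, Fin.sum_univ_three]
  fin_cases i <;> simp <;> ring

/-- Simultaneous in-plane rotation of both frames preserves the Ky Fan sum of any matrix.
[folklore] -/
theorem kyFan_rotate (X : Matrix (Fin 3) (Fin 3) ℝ) (u₁ u₂ v₁ v₂ : Fin 3 → ℝ) {c s : ℝ}
    (hcs : c ^ 2 + s ^ 2 = 1) :
    (c • u₁ + s • u₂) ⬝ᵥ (X *ᵥ (c • v₁ + s • v₂)) + (-s • u₁ + c • u₂) ⬝ᵥ (X *ᵥ (-s • v₁ + c • v₂)) =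
      u₁ ⬝ᵥ (X *ᵥ v₁) + u₂ ⬝ᵥ (X *ᵥ v₂) := by
  simp only [Matrix.mulVec_add, Matrix.mulVec_smul, Matrix.mulVec_neg, dotProduct_add, add_dotProduct,
    dotProduct_smul, smul_dotProduct, neg_smul, dotProduct_neg, neg_dotProduct, smul_eq_mul]
  linear_combination (u₁ ⬝ᵥ (X *ᵥ v₁) + u₂ ⬝ᵥ (X *ᵥ v₂)) * hcs

/-- **Half-angle construction**: for reals `p, q` there is a unit vector `(c, s)` with
`(c² - s²) q = c s p` — the rotation by `θ` with `tan 2θ = 2q/p` — used to annihilate the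
off-diagonal entry of a symmetric `2 × 2` block. [folklore] -/
theorem exists_halfAngle (p q : ℝ) : ∃ c s : ℝ, c ^ 2 + s ^ 2 = 1 ∧ (c ^ 2 - s ^ 2) * q = c * s * p := by
  by_cases hq : q = 0
  · exact ⟨1, 0, by norm_num, by simp [hq]⟩
  -- unit vector `(C, S)` proportional to `(p, 2q)`; then `c = √((1+C)/2)`, `s = sign · √((1-C)/2)`
  have hN : 0 < p ^ 2 + (2 * q) ^ 2 := by positivity
  set N := (p ^ 2 + (2 * q) ^ 2).sqrt with hNdef
  have hN0 : 0 < N := Real.sqrt_pos.2 hN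
  have hNN : N ^ 2 = p ^ 2 + (2 * q) ^ 2 := Real.sq_sqrt hN.le
  set C := p / N with hC
  set S := 2 * q / N with hS
  have hCS : C ^ 2 + S ^ 2 = 1 := by
    rw [hC, hS, div_pow, div_pow, ← add_div, hNN, div_self hN.ne']
  have hC1 : C ≤ 1 := by nlinarith [sq_nonneg S]
  have hC1' : -1 ≤ C := by nlinarith [sq_nonneg S]
  set c := ((1 + C) / 2).sqrt with hc
  have hc2 : c ^ 2 = (1 + C) / 2 := Real.sq_sqrt (by linarith)
  have hSne : S ≠ 0 := by rw [hS]; exact div_ne_zero (by simpa using hq) hN0.ne'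
  -- choose the sign of `s` to match `S`
  obtain ⟨σ, hσ, hσS⟩ : ∃ σ : ℝ, σ ^ 2 = 1 ∧ σ * |S| = S := by
    rcases lt_or_gt_of_ne hSne with h | h
    · exact ⟨-1, by norm_num, by rw [abs_of_neg h]; ring⟩
    · exact ⟨1, by norm_num, by rw [abs_of_pos h]; ring⟩
  set s := σ * ((1 - C) / 2).sqrt with hs
  have hs2 : s ^ 2 = (1 - C) / 2 := by
    rw [hs, mul_pow, hσ, one_mul, Real.sq_sqrt (by linarith)]
  refine ⟨c, s, by rw [hc2, hs2]; ring, ?_⟩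
  -- `c² - s² = C`, `2cs = S`
  have hcs : c * s = S / 2 := by
    have h1 : c * ((1 - C) / 2).sqrt = |S| / 2 := by
      rw [hc, ← Real.sqrt_mul (by linarith), show (1 + C) / 2 * ((1 - C) / 2) = (S / 2) ^ 2 by
        nlinarith [hCS], Real.sqrt_sq_eq_abs, abs_div, abs_two]
    calc c * s = σ * (c * ((1 - C) / 2).sqrt) := by rw [hs]; ring
      _ = S / 2 := by rw [h1, mul_div_assoc', hσS]
  rw [hc2, hs2, hcs, hC, hS]
  field_simp
  ring

/-! ### The maximising configuration -/

section Max

variable {u₁ u₂ v₁ v₂ : Fin 3 → ℝ} (hu₁ : u₁ ⬝ᵥ u₁ = 1) (hu₂ : u₂ ⬝ᵥ u₂ = 1) (hu : u₁ ⬝ᵥ u₂ = 0)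
  (hv₁ : v₁ ⬝ᵥ v₁ = 1) (hv₂ : v₂ ⬝ᵥ v₂ = 1) (hv : v₁ ⬝ᵥ v₂ = 0)
  (hmax : ∀ u₁' u₂' v₁' v₂' : Fin 3 → ℝ, u₁' ⬝ᵥ u₁' = 1 → u₂' ⬝ᵥ u₂' = 1 → u₁' ⬝ᵥ u₂' = 0 →
    v₁' ⬝ᵥ v₁' = 1 → v₂' ⬝ᵥ v₂' = 1 → v₁' ⬝ᵥ v₂' = 0 →
    u₁' ⬝ᵥ (B *ᵥ v₁') + u₂' ⬝ᵥ (B *ᵥ v₂') ≤ u₁ ⬝ᵥ (B *ᵥ v₁) + u₂ ⬝ᵥ (B *ᵥ v₂))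
include hu₁ hu₂ hu hv₁ hv₂ hv hmax

/-- Variations towards the normals: `(u₁ × u₂)ᵀBv₁ = 0`. [folklore] -/
theorem kyFanMax_normal_fst : (u₁ ⨯₃ u₂) ⬝ᵥ (B *ᵥ v₁) = 0 := by
  have hn1 : (u₁ ⨯₃ u₂) ⬝ᵥ (u₁ ⨯₃ u₂) = 1 := dotProduct_cross_self_of_orthonormal hu₁ hu₂ hu
  have hun : u₁ ⬝ᵥ (u₁ ⨯₃ u₂) = 0 := dot_self_cross u₁ u₂
  have hu₂n : u₂ ⬝ᵥ (u₁ ⨯₃ u₂) = 0 := dot_cross_self u₁ u₂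
  refine eq_zero_of_linear_variation (α := u₁ ⬝ᵥ (B *ᵥ v₁)) fun t ↦ ?_
  have hmem := variation_mem hu₁ hn1 hun t
  have horth : ((1 + t ^ 2)⁻¹.sqrt • (u₁ + t • (u₁ ⨯₃ u₂))) ⬝ᵥ u₂ = 0 := by
    simp [smul_dotProduct, add_dotProduct, hu, dotProduct_comm (u₁ ⨯₃ u₂) u₂, hu₂n]
  have h := hmax _ u₂ v₁ v₂ hmem hu₂ horth hv₁ hv₂ hv
  simp only [smul_dotProduct, add_dotProduct, smul_eq_mul] at h
  linarith

/-- Variations towards the normals: `(u₁ × u₂)ᵀBv₂ = 0`. [folklore] -/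
theorem kyFanMax_normal_snd : (u₁ ⨯₃ u₂) ⬝ᵥ (B *ᵥ v₂) = 0 := by
  have hn1 : (u₁ ⨯₃ u₂) ⬝ᵥ (u₁ ⨯₃ u₂) = 1 := dotProduct_cross_self_of_orthonormal hu₁ hu₂ hu
  have hun : u₁ ⬝ᵥ (u₁ ⨯₃ u₂) = 0 := dot_self_cross u₁ u₂
  have hu₂n : u₂ ⬝ᵥ (u₁ ⨯₃ u₂) = 0 := dot_cross_self u₁ u₂
  refine eq_zero_of_linear_variation (α := u₂ ⬝ᵥ (B *ᵥ v₂)) fun t ↦ ?_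
  have hmem := variation_mem hu₂ hn1 hu₂n t
  have horth : u₁ ⬝ᵥ ((1 + t ^ 2)⁻¹.sqrt • (u₂ + t • (u₁ ⨯₃ u₂))) = 0 := by
    simp [dotProduct_smul, dotProduct_add, hu, hun]
  have h := hmax u₁ _ v₁ v₂ hu₁ hmem horth hv₁ hv₂ hv
  simp only [smul_dotProduct, add_dotProduct, smul_eq_mul] at h
  linarith

/-- Variations towards the normals: `u₁ᵀB(v₁ × v₂) = 0`. [folklore] -/
theorem kyFanMax_normal_fst' : u₁ ⬝ᵥ (B *ᵥ (v₁ ⨯₃ v₂)) = 0 := by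
  have hn1 : (v₁ ⨯₃ v₂) ⬝ᵥ (v₁ ⨯₃ v₂) = 1 := dotProduct_cross_self_of_orthonormal hv₁ hv₂ hv
  have hvn : v₁ ⬝ᵥ (v₁ ⨯₃ v₂) = 0 := dot_self_cross v₁ v₂
  have hv₂n : v₂ ⬝ᵥ (v₁ ⨯₃ v₂) = 0 := dot_cross_self v₁ v₂
  refine eq_zero_of_linear_variation (α := u₁ ⬝ᵥ (B *ᵥ v₁)) fun t ↦ ?_
  have hmem := variation_mem hv₁ hn1 hvn t
  have horth : ((1 + t ^ 2)⁻¹.sqrt • (v₁ + t • (v₁ ⨯₃ v₂))) ⬝ᵥ v₂ = 0 := by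
    simp [smul_dotProduct, add_dotProduct, hv, dotProduct_comm (v₁ ⨯₃ v₂) v₂, hv₂n]
  have h := hmax u₁ u₂ _ v₂ hu₁ hu₂ hu hmem hv₂ horth
  simp only [Matrix.mulVec_smul, Matrix.mulVec_add, dotProduct_smul, dotProduct_add, smul_eq_mul] at h
  linarith

/-- Variations towards the normals: `u₂ᵀB(v₁ × v₂) = 0`. [folklore] -/
theorem kyFanMax_normal_snd' : u₂ ⬝ᵥ (B *ᵥ (v₁ ⨯₃ v₂)) = 0 := by
  have hn1 : (v₁ ⨯₃ v₂) ⬝ᵥ (v₁ ⨯₃ v₂) = 1 := dotProduct_cross_self_of_orthonormal hv₁ hv₂ hv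
  have hvn : v₁ ⬝ᵥ (v₁ ⨯₃ v₂) = 0 := dot_self_cross v₁ v₂
  have hv₂n : v₂ ⬝ᵥ (v₁ ⨯₃ v₂) = 0 := dot_cross_self v₁ v₂
  refine eq_zero_of_linear_variation (α := u₂ ⬝ᵥ (B *ᵥ v₂)) fun t ↦ ?_
  have hmem := variation_mem hv₂ hn1 hv₂n t
  have horth : v₁ ⬝ᵥ ((1 + t ^ 2)⁻¹.sqrt • (v₂ + t • (v₁ ⨯₃ v₂))) = 0 := by
    simp [dotProduct_smul, dotProduct_add, hv, hvn]
  have h := hmax u₁ u₂ v₁ _ hu₁ hu₂ hu hv₁ hmem horth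
  simp only [Matrix.mulVec_smul, Matrix.mulVec_add, dotProduct_smul, dotProduct_add, smul_eq_mul] at h
  linarith

/-- **The block is symmetric**: `u₂ᵀBv₁ = u₁ᵀBv₂` (in-plane rotation of the `u`-frame). [folklore] -/
theorem kyFanMax_symm : u₂ ⬝ᵥ (B *ᵥ v₁) = u₁ ⬝ᵥ (B *ᵥ v₂) := by
  -- `c T + s D ≤ T` for all unit `(c, s)`, `T` the value, `D = M₂₁ - M₁₂`; take `(c, s) ∝ (T, D)`
  set T := u₁ ⬝ᵥ (B *ᵥ v₁) + u₂ ⬝ᵥ (B *ᵥ v₂) with hT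
  set D := u₂ ⬝ᵥ (B *ᵥ v₁) - u₁ ⬝ᵥ (B *ᵥ v₂) with hD
  have hrot : ∀ c s : ℝ, c ^ 2 + s ^ 2 = 1 → c * T + s * D ≤ T := by
    intro c s hcs
    obtain ⟨h1, h2, h12⟩ := rotate_orthonormal hu₁ hu₂ hu hcs (σ := 1) (by norm_num)
    simp only [one_mul] at h2 h12
    have h := hmax _ _ v₁ v₂ h1 h2 h12 hv₁ hv₂ hv
    simp only [add_dotProduct, smul_dotProduct, neg_smul, neg_dotProduct, smul_eq_mul] at h
    rw [hT, hD]; nlinarith [h]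
  by_contra hne
  have hD0 : D ≠ 0 := sub_ne_zero.2 hne
  have hN : 0 < T ^ 2 + D ^ 2 := by positivity
  set N := (T ^ 2 + D ^ 2).sqrt
  have hN0 : 0 < N := Real.sqrt_pos.2 hN
  have hNN : N ^ 2 = T ^ 2 + D ^ 2 := Real.sq_sqrt hN.le
  have h := hrot (T / N) (D / N) (by rw [div_pow, div_pow, ← add_div, hNN, div_self hN.ne'])
  rw [div_mul_eq_mul_div, div_mul_eq_mul_div, ← add_div, div_le_iff₀ hN0] at h
  -- `T² + D² ≤ T N`, so `N² ≤ T N`, `N ≤ T`, but `N > |T|` since `D ≠ 0`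
  have h1 : N ≤ T := by nlinarith
  have h2 : T ^ 2 < N ^ 2 := by rw [hNN]; nlinarith [sq_pos_of_ne_zero hD0]
  nlinarith

/-- **Diagonal entries are non-negative**: `u₁ᵀBv₁ ≥ 0` (flip `u₁`). [folklore] -/
theorem kyFanMax_diag_nonneg_fst : 0 ≤ u₁ ⬝ᵥ (B *ᵥ v₁) := by
  have h := hmax (-u₁) u₂ v₁ v₂ (by simp [hu₁]) hu₂ (by simp [hu]) hv₁ hv₂ hv
  rw [neg_dotProduct] at h; linarith

/-- `u₂ᵀBv₂ ≥ 0`. [folklore] -/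
theorem kyFanMax_diag_nonneg_snd : 0 ≤ u₂ ⬝ᵥ (B *ᵥ v₂) := by
  have h := hmax u₁ (-u₂) v₁ v₂ hu₁ (by simp [hu₂]) (by simp [hu]) hv₁ hv₂ hv
  rw [neg_dotProduct] at h; linarith

/-- **`|κ| ≤ u₁ᵀBv₁`** for `κ = (u₁ × u₂)ᵀB(v₁ × v₂)` (competitors `(±u₀, u₂; v₀, v₂)`). [folklore] -/
theorem kyFanMax_kappa_le_fst : |(u₁ ⨯₃ u₂) ⬝ᵥ (B *ᵥ (v₁ ⨯₃ v₂))| ≤ u₁ ⬝ᵥ (B *ᵥ v₁) := by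
  have hn1 : (u₁ ⨯₃ u₂) ⬝ᵥ (u₁ ⨯₃ u₂) = 1 := dotProduct_cross_self_of_orthonormal hu₁ hu₂ hu
  have hm1 : (v₁ ⨯₃ v₂) ⬝ᵥ (v₁ ⨯₃ v₂) = 1 := dotProduct_cross_self_of_orthonormal hv₁ hv₂ hv
  have hu₂n : (u₁ ⨯₃ u₂) ⬝ᵥ u₂ = 0 := by rw [dotProduct_comm]; exact dot_cross_self u₁ u₂
  have hv₂n : (v₁ ⨯₃ v₂) ⬝ᵥ v₂ = 0 := by rw [dotProduct_comm]; exact dot_cross_self v₁ v₂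
  have h1 := hmax (u₁ ⨯₃ u₂) u₂ (v₁ ⨯₃ v₂) v₂ hn1 hu₂ hu₂n hm1 hv₂ hv₂n
  have h2 := hmax (-(u₁ ⨯₃ u₂)) u₂ (v₁ ⨯₃ v₂) v₂
    (by rw [neg_dotProduct, dotProduct_neg, neg_neg, hn1]) hu₂ (by rw [neg_dotProduct, hu₂n, neg_zero])
    hm1 hv₂ hv₂n
  rw [neg_dotProduct] at h2
  exact abs_le.2 ⟨by linarith, by linarith⟩

/-- `|κ| ≤ u₂ᵀBv₂` (competitors `(u₁, ±u₀; v₁, v₀)`). [folklore] -/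
theorem kyFanMax_kappa_le_snd : |(u₁ ⨯₃ u₂) ⬝ᵥ (B *ᵥ (v₁ ⨯₃ v₂))| ≤ u₂ ⬝ᵥ (B *ᵥ v₂) := by
  have hn1 : (u₁ ⨯₃ u₂) ⬝ᵥ (u₁ ⨯₃ u₂) = 1 := dotProduct_cross_self_of_orthonormal hu₁ hu₂ hu
  have hm1 : (v₁ ⨯₃ v₂) ⬝ᵥ (v₁ ⨯₃ v₂) = 1 := dotProduct_cross_self_of_orthonormal hv₁ hv₂ hv
  have hu₁n : u₁ ⬝ᵥ (u₁ ⨯₃ u₂) = 0 := dot_self_cross u₁ u₂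
  have hv₁n : v₁ ⬝ᵥ (v₁ ⨯₃ v₂) = 0 := dot_self_cross v₁ v₂
  have h1 := hmax u₁ (u₁ ⨯₃ u₂) v₁ (v₁ ⨯₃ v₂) hu₁ hn1 hu₁n hv₁ hm1 hv₁n
  have h2 := hmax u₁ (-(u₁ ⨯₃ u₂)) v₁ (v₁ ⨯₃ v₂) hu₁
    (by rw [neg_dotProduct, dotProduct_neg, neg_neg, hn1]) (by rw [dotProduct_neg, hu₁n, neg_zero]) hv₁
    hm1 hv₁n
  rw [neg_dotProduct] at h2
  exact abs_le.2 ⟨by linarith, by linarith⟩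

/-- **`Bv₀ = κu₀`**, `v₀ = v₁ × v₂`, `u₀ = u₁ × u₂`. [folklore] -/
theorem kyFanMax_mulVec_normal :
    B *ᵥ (v₁ ⨯₃ v₂) = ((u₁ ⨯₃ u₂) ⬝ᵥ (B *ᵥ (v₁ ⨯₃ v₂))) • (u₁ ⨯₃ u₂) := by
  have hn1 : (u₁ ⨯₃ u₂) ⬝ᵥ (u₁ ⨯₃ u₂) = 1 := dotProduct_cross_self_of_orthonormal hu₁ hu₂ hu
  have hu₁n : u₁ ⬝ᵥ (u₁ ⨯₃ u₂) = 0 := dot_self_cross u₁ u₂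
  have hu₂n : u₂ ⬝ᵥ (u₁ ⨯₃ u₂) = 0 := dot_cross_self u₁ u₂
  have h := expand_orthonormal hu₁ hu₂ hn1 hu hu₁n hu₂n (B *ᵥ (v₁ ⨯₃ v₂))
  rw [kyFanMax_normal_fst' hu₁ hu₂ hu hv₁ hv₂ hv hmax, kyFanMax_normal_snd' hu₁ hu₂ hu hv₁ hv₂ hv hmax,
    zero_smul, zero_smul, zero_add, zero_add] at h
  exact h

/-- **`Bv₁ = M₁₁u₁ + M₁₂u₂`** (with `M₁₂ = M₂₁`). [folklore] -/
theorem kyFanMax_mulVec_fst :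
    B *ᵥ v₁ = (u₁ ⬝ᵥ (B *ᵥ v₁)) • u₁ + (u₁ ⬝ᵥ (B *ᵥ v₂)) • u₂ := by
  have hn1 : (u₁ ⨯₃ u₂) ⬝ᵥ (u₁ ⨯₃ u₂) = 1 := dotProduct_cross_self_of_orthonormal hu₁ hu₂ hu
  have hu₁n : u₁ ⬝ᵥ (u₁ ⨯₃ u₂) = 0 := dot_self_cross u₁ u₂
  have hu₂n : u₂ ⬝ᵥ (u₁ ⨯₃ u₂) = 0 := dot_cross_self u₁ u₂
  have h := expand_orthonormal hu₁ hu₂ hn1 hu hu₁n hu₂n (B *ᵥ v₁)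
  rw [kyFanMax_normal_fst hu₁ hu₂ hu hv₁ hv₂ hv hmax, zero_smul, add_zero,
    kyFanMax_symm hu₁ hu₂ hu hv₁ hv₂ hv hmax] at h
  exact h

/-- **`Bv₂ = M₁₂u₁ + M₂₂u₂`**. [folklore] -/
theorem kyFanMax_mulVec_snd :
    B *ᵥ v₂ = (u₁ ⬝ᵥ (B *ᵥ v₂)) • u₁ + (u₂ ⬝ᵥ (B *ᵥ v₂)) • u₂ := by
  have hn1 : (u₁ ⨯₃ u₂) ⬝ᵥ (u₁ ⨯₃ u₂) = 1 := dotProduct_cross_self_of_orthonormal hu₁ hu₂ hu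
  have hu₁n : u₁ ⬝ᵥ (u₁ ⨯₃ u₂) = 0 := dot_self_cross u₁ u₂
  have hu₂n : u₂ ⬝ᵥ (u₁ ⨯₃ u₂) = 0 := dot_cross_self u₁ u₂
  have h := expand_orthonormal hu₁ hu₂ hn1 hu hu₁n hu₂n (B *ᵥ v₂)
  rw [kyFanMax_normal_snd hu₁ hu₂ hu hv₁ hv₂ hv hmax, zero_smul, add_zero] at h
  exact h

/-- **Hamilton's `B^#`-terms at a maximiser**: `u₁ᵀB^#v₁ + u₂ᵀB^#v₂ = κ(M₁₁ + M₂₂)`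
(`B^#v₁ = Bv₂ × Bv₀` etc.; Hamilton 1986: "`2b₁b₂`", "`2b₁b₃`"). [cite: Hamilton1997, §2.1, Thm. 1.3 (proof, p. 8)] -/
theorem kyFanMax_sharp_sum :
    u₁ ⬝ᵥ (B.sharp *ᵥ v₁) + u₂ ⬝ᵥ (B.sharp *ᵥ v₂) =
      ((u₁ ⨯₃ u₂) ⬝ᵥ (B *ᵥ (v₁ ⨯₃ v₂))) * (u₁ ⬝ᵥ (B *ᵥ v₁) + u₂ ⬝ᵥ (B *ᵥ v₂)) := by
  -- right-handed frames: `v₁ = v₂ × v₀`, `v₂ = v₀ × v₁`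
  have hvu : v₂ ⬝ᵥ v₁ = 0 := by rw [dotProduct_comm]; exact hv
  have huu : u₂ ⬝ᵥ u₁ = 0 := by rw [dotProduct_comm]; exact hu
  have ev₁ : v₁ = v₂ ⨯₃ (v₁ ⨯₃ v₂) := by
    rw [cross_cross_eq_smul_sub_smul']; simp [hv₂, hv]
  have ev₂ : v₂ = (v₁ ⨯₃ v₂) ⨯₃ v₁ := by
    rw [cross_cross_eq_smul_sub_smul]; simp [hv₁, hvu]
  have eu₁ : u₁ ⬝ᵥ (u₂ ⨯₃ (u₁ ⨯₃ u₂)) = 1 := by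
    rw [cross_cross_eq_smul_sub_smul']; simp [hu₂, hu, hu₁]
  have eu₂ : u₂ ⬝ᵥ ((u₁ ⨯₃ u₂) ⨯₃ u₁) = 1 := by
    rw [cross_cross_eq_smul_sub_smul]; simp [hu₁, huu, hu₂]
  have hB0 := kyFanMax_mulVec_normal hu₁ hu₂ hu hv₁ hv₂ hv hmax
  have hB1 := kyFanMax_mulVec_fst hu₁ hu₂ hu hv₁ hv₂ hv hmax
  have hB2 := kyFanMax_mulVec_snd hu₁ hu₂ hu hv₁ hv₂ hv hmax
  conv_lhs => arg 1; rw [ev₁, sharp_mulVec_cross, hB2, hB0]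
  conv_lhs => arg 2; rw [ev₂, sharp_mulVec_cross, hB0, hB1]
  simp only [map_add, map_smul, LinearMap.add_apply, LinearMap.smul_apply, dotProduct_add, dotProduct_smul,
    smul_eq_mul]
  rw [show u₁ ⬝ᵥ (u₁ ⨯₃ (u₁ ⨯₃ u₂)) = 0 from dot_self_cross _ _, eu₁,
    show u₂ ⬝ᵥ ((u₁ ⨯₃ u₂) ⨯₃ u₂) = 0 from dot_cross_self _ _, eu₂]
  ring

end Max

end HamiltonODE

end Literature.Geometry.Riemannian

end
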